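import Summits.KontsevichZagierPeriods.KontsevichZagierPeriods.Theorems.HurwitzMicroSectorsNormalFormPrincipleM4RelDilations4
import Summits.KontsevichZagierPeriods.KontsevichZagierPeriods.Theorems.HurwitzMicroSectorsNormalFormPrincipleM4ExistsWordRep4
import Summits.KontsevichZagierPeriods.KontsevichZagierPeriods.Theorems.HurwitzMicroSectorsNormalFormPrincipleM4BoxSubSimplex4
import Literature.NumberTheory.Transcendental.KZSubcalculusInvariants

/-!
# `NormalFormPrinciple` (stmt-KontsevichZagierPeriods-3869), line `SketchIdeator1` —
# leaf `stub_boxRigidity`, layer `M4`: the distribution instance `8η(4) = 7ζ(4)` in dimension four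

Pure proof file (lead seat c9; `--supports` the crux). A transcendence-free equal-value pair of
RATIONAL four-dimensional boxes settled by a chain of Kontsevich–Zagier moves:

  `8·[□⁴, 1/(1 + x₀x₁x₂x₃)] ∼ 7·[□⁴, 1/(1 − x₀x₁x₂x₃)]`   (both of value `7ζ(4) = π⁴·7/90`),

i.e. the DISTRIBUTION relation `η(4) = (7/8)ζ(4)` of weight four read in the calculus: the two
boxes chart (rule (2), the cubical chart `m4_box_sub_simplex4`) onto `8[aaac]` and `7[aaab]`
(words on the decreasing simplex `Δ₄`, `a = dt/t`, `b = dt/(1−t)`, `c = dt/(1+t)`), and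
`8[aaac] − 7[aaab] ∈ KZ.relations` is the dilation relation of the word `aaab` (ONE change of
variables `t ↦ t²` plus integrand additivity, the landed package `m4_rel_dilations4`).
Companion of the stuffle instance `m4_twoEtaFour` (`2η(4) = ζ(4) + ζ(2,2)`).
References: M. Kontsevich, D. Zagier, *Periods* (2001), §1.2 rules (1), (2); A. B. Goncharov,
*Multiple polylogarithms and mixed Tate motives* (2001), §2. No definitions are introduced.
-/

noncomputable section

open MeasureTheory Set
open Literature.NumberTheory.Transcendental Literature.NumberTheory.Transcendental.KZ

namespace Summit.KontsevichZagierPeriods.HurwitzMicroSectors.NormalFormPrinciple.PiBox.M3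

/-- **The distribution instance in dimension four** (lead seat c9, line `SketchIdeator1`, layer
`M4`). For representations `r = [□⁴, ≡ 8/(1 + x₀x₁x₂x₃)]` and `r' = [□⁴, ≡ 7/(1 − x₀x₁x₂x₃)]`
on the open unit box: `r ∼ r'` under the Kontsevich–Zagier moves (`8η(4) = 7ζ(4)`).
[cite: KontsevichZagier2001, §1.2 rules (1), (2)] -/
theorem m4_etaFour_distribution :
    ∀ (r r' : IntegralRep 4), r.domain = {x | ∀ i, x i ∈ Set.Ioo (0:ℝ) 1} →
      EqOn r.integrand (fun x => 8 / (1 + x 0 * x 1 * x 2 * x 3)) r.domain →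
      r'.domain = {x | ∀ i, x i ∈ Set.Ioo (0:ℝ) 1} →
      EqOn r'.integrand (fun x => 7 / (1 - x 0 * x 1 * x 2 * x 3)) r'.domain →
      Equivalent r r' := by
  intro r r' hrd hri hr'd hr'i
  obtain ⟨AAAB, hAAABd, hAAABi⟩ : ∃ T : IntegralRep 4, T.domain = {t | 0 < t 3 ∧ t 3 < t 2 ∧ t 2 < t 1 ∧ t 1 < t 0 ∧ t 0 < 1} ∧
      (T.integrand = fun t => 1 / t 0 * (1 / t 1) * (1 / t 2) * (1 / (1 - t 3))) :=
    m4_exists_wordRep4 (fun u => 1 / u) (fun u => 1 / u) (fun u => 1 / u) (fun u => 1 / (1 - u)) (Or.inl rfl) (Or.inl rfl) (Or.inl rfl) (Or.inl rfl)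
  obtain ⟨AAAC, hAAACd, hAAACi⟩ : ∃ T : IntegralRep 4, T.domain = {t | 0 < t 3 ∧ t 3 < t 2 ∧ t 2 < t 1 ∧ t 1 < t 0 ∧ t 0 < 1} ∧
      (T.integrand = fun t => 1 / t 0 * (1 / t 1) * (1 / t 2) * (1 / (1 + t 3))) :=
    m4_exists_wordRep4 (fun u => 1 / u) (fun u => 1 / u) (fun u => 1 / u) (fun u => 1 / (1 + u)) (Or.inl rfl) (Or.inl rfl) (Or.inl rfl) (Or.inr rfl)
  obtain ⟨AABB, hAABBd, hAABBi⟩ : ∃ T : IntegralRep 4, T.domain = {t | 0 < t 3 ∧ t 3 < t 2 ∧ t 2 < t 1 ∧ t 1 < t 0 ∧ t 0 < 1} ∧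
      (T.integrand = fun t => 1 / t 0 * (1 / t 1) * (1 / (1 - t 2)) * (1 / (1 - t 3))) :=
    m4_exists_wordRep4 (fun u => 1 / u) (fun u => 1 / u) (fun u => 1 / (1 - u)) (fun u => 1 / (1 - u)) (Or.inl rfl) (Or.inl rfl) (Or.inr (Or.inl rfl)) (Or.inl rfl)
  obtain ⟨AABC, hAABCd, hAABCi⟩ : ∃ T : IntegralRep 4, T.domain = {t | 0 < t 3 ∧ t 3 < t 2 ∧ t 2 < t 1 ∧ t 1 < t 0 ∧ t 0 < 1} ∧
      (T.integrand = fun t => 1 / t 0 * (1 / t 1) * (1 / (1 - t 2)) * (1 / (1 + t 3))) :=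
    m4_exists_wordRep4 (fun u => 1 / u) (fun u => 1 / u) (fun u => 1 / (1 - u)) (fun u => 1 / (1 + u)) (Or.inl rfl) (Or.inl rfl) (Or.inr (Or.inl rfl)) (Or.inr rfl)
  obtain ⟨AACB, hAACBd, hAACBi⟩ : ∃ T : IntegralRep 4, T.domain = {t | 0 < t 3 ∧ t 3 < t 2 ∧ t 2 < t 1 ∧ t 1 < t 0 ∧ t 0 < 1} ∧
      (T.integrand = fun t => 1 / t 0 * (1 / t 1) * (1 / (1 + t 2)) * (1 / (1 - t 3))) :=
    m4_exists_wordRep4 (fun u => 1 / u) (fun u => 1 / u) (fun u => 1 / (1 + u)) (fun u => 1 / (1 - u)) (Or.inl rfl) (Or.inl rfl) (Or.inr (Or.inr rfl)) (Or.inl rfl)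
  obtain ⟨AACC, hAACCd, hAACCi⟩ : ∃ T : IntegralRep 4, T.domain = {t | 0 < t 3 ∧ t 3 < t 2 ∧ t 2 < t 1 ∧ t 1 < t 0 ∧ t 0 < 1} ∧
      (T.integrand = fun t => 1 / t 0 * (1 / t 1) * (1 / (1 + t 2)) * (1 / (1 + t 3))) :=
    m4_exists_wordRep4 (fun u => 1 / u) (fun u => 1 / u) (fun u => 1 / (1 + u)) (fun u => 1 / (1 + u)) (Or.inl rfl) (Or.inl rfl) (Or.inr (Or.inr rfl)) (Or.inr rfl)
  obtain ⟨ABAB, hABABd, hABABi⟩ : ∃ T : IntegralRep 4, T.domain = {t | 0 < t 3 ∧ t 3 < t 2 ∧ t 2 < t 1 ∧ t 1 < t 0 ∧ t 0 < 1} ∧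
      (T.integrand = fun t => 1 / t 0 * (1 / (1 - t 1)) * (1 / t 2) * (1 / (1 - t 3))) :=
    m4_exists_wordRep4 (fun u => 1 / u) (fun u => 1 / (1 - u)) (fun u => 1 / u) (fun u => 1 / (1 - u)) (Or.inl rfl) (Or.inr (Or.inl rfl)) (Or.inl rfl) (Or.inl rfl)
  obtain ⟨ABAC, hABACd, hABACi⟩ : ∃ T : IntegralRep 4, T.domain = {t | 0 < t 3 ∧ t 3 < t 2 ∧ t 2 < t 1 ∧ t 1 < t 0 ∧ t 0 < 1} ∧
      (T.integrand = fun t => 1 / t 0 * (1 / (1 - t 1)) * (1 / t 2) * (1 / (1 + t 3))) :=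
    m4_exists_wordRep4 (fun u => 1 / u) (fun u => 1 / (1 - u)) (fun u => 1 / u) (fun u => 1 / (1 + u)) (Or.inl rfl) (Or.inr (Or.inl rfl)) (Or.inl rfl) (Or.inr rfl)
  obtain ⟨ACAB, hACABd, hACABi⟩ : ∃ T : IntegralRep 4, T.domain = {t | 0 < t 3 ∧ t 3 < t 2 ∧ t 2 < t 1 ∧ t 1 < t 0 ∧ t 0 < 1} ∧
      (T.integrand = fun t => 1 / t 0 * (1 / (1 + t 1)) * (1 / t 2) * (1 / (1 - t 3))) :=
    m4_exists_wordRep4 (fun u => 1 / u) (fun u => 1 / (1 + u)) (fun u => 1 / u) (fun u => 1 / (1 - u)) (Or.inl rfl) (Or.inr (Or.inr rfl)) (Or.inl rfl) (Or.inl rfl)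
  obtain ⟨ACAC, hACACd, hACACi⟩ : ∃ T : IntegralRep 4, T.domain = {t | 0 < t 3 ∧ t 3 < t 2 ∧ t 2 < t 1 ∧ t 1 < t 0 ∧ t 0 < 1} ∧
      (T.integrand = fun t => 1 / t 0 * (1 / (1 + t 1)) * (1 / t 2) * (1 / (1 + t 3))) :=
    m4_exists_wordRep4 (fun u => 1 / u) (fun u => 1 / (1 + u)) (fun u => 1 / u) (fun u => 1 / (1 + u)) (Or.inl rfl) (Or.inr (Or.inr rfl)) (Or.inl rfl) (Or.inr rfl)
  obtain ⟨d1, -, -⟩ := m4_rel_dilations4 AAAB hAAABd hAAABi AAAC hAAACd hAAACi AABB hAABBd hAABBi AABC hAABCd hAABCi AACB hAACBd hAACBi AACC hAACCd hAACCi ABAB hABABd hABABi ABAC hABACd hABACi ACAB hACABd hACABi ACAC hACACd hACACi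
  have hbox : ∀ x ∈ {x : Fin 4 → ℝ | ∀ i, x i ∈ Set.Ioo (0:ℝ) 1},
      0 < x 0 ∧ 0 < x 1 ∧ 0 < x 2 ∧ x 0 * x 1 * x 2 * x 3 < 1 := by
    intro x hx
    have h01 : x 0 * x 1 < 1 := mul_lt_one_of_nonneg_of_lt_one_left (hx 0).1.le (hx 0).2 (hx 1).2.le
    have h012 : x 0 * x 1 * x 2 < 1 :=
      mul_lt_one_of_nonneg_of_lt_one_left (mul_pos (hx 0).1 (hx 1).1).le h01 (hx 2).2.le
    exact ⟨(hx 0).1, (hx 1).1, (hx 2).1, mul_lt_one_of_nonneg_of_lt_one_left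
      (mul_pos (mul_pos (hx 0).1 (hx 1).1) (hx 2).1).le h012 (hx 3).2.le⟩
  -- `[r] = 8[aaac]`
  set T8 : IntegralRep 4 := AAAC.constMul ((8:ℕ):ℝ) (isAlgebraic_nat 8) with hT8
  have c1 : of r - of T8 ∈ relations := by
    refine m4_box_sub_simplex4.1
      (fun t => ((8:ℕ):ℝ) * (1 / t 0 * (1 / t 1) * (1 / t 2) * (1 / (1 + t 3)))) r T8 hrd
      (by rw [hT8, IntegralRep.domain_constMul, hAAACd])
      (fun t _ => by rw [hT8, IntegralRep.integrand_constMul, hAAACi]) fun x hx => ?_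
    rw [hrd] at hx
    obtain ⟨h0, h1, h2, hP⟩ := hbox x hx
    have hx3 : 0 < x 3 := (hx 3).1
    rw [hri (hrd ▸ hx)]
    simp only [Matrix.cons_val_zero, Matrix.cons_val_one, Matrix.head_cons, Matrix.cons_val_two,
      Matrix.tail_cons, Matrix.cons_val_three]
    push_cast
    field_simp
  have c2 : of T8 - (8:ℕ) • of AAAC ∈ relations :=
    IntegralRep.of_constMul_nat_sub_nsmul_mem_relations AAAC 8
  -- `[r'] = 7[aaab]`
  set T7 : IntegralRep 4 := AAAB.constMul ((7:ℕ):ℝ) (isAlgebraic_nat 7) with hT7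
  have c3 : of r' - of T7 ∈ relations := by
    refine m4_box_sub_simplex4.1
      (fun t => ((7:ℕ):ℝ) * (1 / t 0 * (1 / t 1) * (1 / t 2) * (1 / (1 - t 3)))) r' T7 hr'd
      (by rw [hT7, IntegralRep.domain_constMul, hAAABd])
      (fun t _ => by rw [hT7, IntegralRep.integrand_constMul, hAAABi]) fun x hx => ?_
    rw [hr'd] at hx
    obtain ⟨h0, h1, h2, hP⟩ := hbox x hx
    have hP' : 1 - x 0 * x 1 * x 2 * x 3 ≠ 0 := by linarith
    rw [hr'i (hr'd ▸ hx)]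
    simp only [Matrix.cons_val_zero, Matrix.cons_val_one, Matrix.head_cons, Matrix.cons_val_two,
      Matrix.tail_cons, Matrix.cons_val_three]
    push_cast
    field_simp
  have c4 : of T7 - (7:ℕ) • of AAAB ∈ relations :=
    IntegralRep.of_constMul_nat_sub_nsmul_mem_relations AAAB 7
  show of r - of r' ∈ relations
  have e : of r - of r' = (of r - of T8) + (of T8 - (8:ℕ) • of AAAC) +
      ((8:ℤ) • of AAAC - (7:ℤ) • of AAAB) - (of T7 - (7:ℕ) • of AAAB) - (of r' - of T7) := by
    abel
  rw [e]
  exact relations.sub_mem (relations.sub_mem (relations.add_mem (relations.add_mem c1 c2) d1) c4) c3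

end Summit.KontsevichZagierPeriods.HurwitzMicroSectors.NormalFormPrinciple.PiBox.M3
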